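import Summits.ValiantsHypothesis.ValiantsHypothesis.Theorems.LangWeilTransferTameResolutionEliminantSizes
import Summits.ValiantsHypothesis.ValiantsHypothesis.Theorems.LangWeilTransferTameResolutionSpecializeSizes
import Summits.ValiantsHypothesis.ValiantsHypothesis.Theorems.LangWeilTransferTameResolutionFactorSizes

/-!
# LangWeilTransfer, support item `TameResolution` (stmt-ValiantsHypothesis-6378) — sizes of the
# irreducible factor `q ∣ 𝒬_a` of the specialised eliminant

Route `LangWeilTransfer` of `ValiantsHypothesis` (conditional route; honest framing: bookkeeping,
nothing here bears on VP ≠ VNP). Quantitative pass (roadmap note of val-lit-p6 g9, §4 (S), first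
link of the chain): for the data `a, q` exported by `exists_parametrisation_explicit`
(`q ∣ 𝒬.map σ_a`, `a ≤ N_a`), the flattened coefficients
`flat₁ (q.coeff i) ∈ ℤ[Fin (n + r)]` (`flat₁ = rename finSumFinEquiv ∘ (sumAlgEquiv ℤ (Fin n) (Fin r))⁻¹`)
have explicitly bounded total degree and weight, and `deg_U q ≤ (d+1)ⁿ`. Chain:
`EliminantSizes` (𝒬) → `SpecializeSizes` (σ_a) → `FactorSizes` (q ∣ 𝒬_a, over `ℤ[Fin (n+r)][U]`).

* `flatMap_sizes` — sizes of `(𝒬.map σ_a).map flat₁`;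
* `q_sizes` — sizes of `q`.
-/

noncomputable section

open MvPolynomial
open Literature.RingTheory.Elimination Literature.Computability.AlgebraicComplexity

-- the summit and the problem share the name `ValiantsHypothesis` (D-0017 single-conjunct layout)
set_option linter.dupNamespace false

namespace Summit.ValiantsHypothesis.ValiantsHypothesis.Theorems.LangWeilTransfer

variable {r n t d : ℕ}

/-- **Sizes of the flattened specialised eliminant `𝒬_a`.** -/
theorem flatMap_specA_sizes (S : Fin t → MvPolynomial (Fin n) (MvPolynomial (Fin r) ℤ))
    {dT w₁ Na : ℕ} (hST : ∀ k β, ((S k).coeff β).totalDegree ≤ dT)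
    (hSw : ∀ k, ((S k).support.sum fun β => weight ((S k).coeff β)) ≤ w₁)
    (a : Fin n × Fin t → ℕ) (hNa : 1 ≤ Na) (ha : ∀ p, a p ≤ Na) (k₀ : ℕ) :
    let ι := Fin r ⊕ (Fin n ⊕ (Fin n × Fin t))
    let F : Fin n → MvPolynomial (Fin n) (MvPolynomial ι ℤ) := fun i =>
      ∑ k, C (X (Sum.inr (Sum.inr (i, k)))) *
        MvPolynomial.map (rename (Sum.inl : Fin r → ι) : MvPolynomial (Fin r) ℤ →ₐ[ℤ] MvPolynomial ι ℤ).toRingHom (S k)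
    let uU : MvPolynomial (Fin n) (MvPolynomial ι ℤ) := ∑ j, C (X (Sum.inr (Sum.inl j))) * X j
    let 𝒬 := sLead (pertCharpoly (d + 1) F uU k₀)
    let σa : MvPolynomial ι ℤ →+* MvPolynomial (Fin n) (MvPolynomial (Fin r) ℤ) :=
      eval₂Hom (C.comp C) (Sum.elim (fun k => C (X k)) (Sum.elim (fun j => X j) (fun p => C (C ((a p : ℕ) : ℤ)))))
    let flat₁ : MvPolynomial (Fin n) (MvPolynomial (Fin r) ℤ) →+* MvPolynomial (Fin (n + r)) ℤ :=
      (rename finSumFinEquiv : MvPolynomial (Fin n ⊕ Fin r) ℤ →ₐ[ℤ] MvPolynomial (Fin (n + r)) ℤ).toRingHom.comp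
        (sumAlgEquiv ℤ (Fin n) (Fin r)).symm.toRingEquiv.toRingHom
    ((𝒬.map σa).map flat₁).natDegree ≤ (d + 1) ^ n ∧
    (∀ i, (((𝒬.map σa).map flat₁).coeff i).totalDegree ≤ (d + 1) ^ n * (1 + k₀ * (dT + 1))) ∧
    (∀ i, weight (((𝒬.map σa).map flat₁).coeff i) ≤
      (1 + (1 + t * w₁) ^ k₀ * n) ^ ((d + 1) ^ n) * Na ^ ((d + 1) ^ n * (1 + k₀ * (dT + 1)))) := by
  intro ι F uU 𝒬 σa flat₁
  have hdeg𝒬 := natDegree_universalEliminant_le (d := d) S k₀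
  have hcoeff𝒬 := totalDegree_coeff_universalEliminant_le (d := d) S hST k₀
  have hwt𝒬 := weight_coeff_universalEliminant_le (d := d) S hSw k₀
  simp only at hdeg𝒬 hcoeff𝒬 hwt𝒬
  refine ⟨?_, fun i => ?_, fun i => ?_⟩
  · exact (Polynomial.natDegree_map_le.trans Polynomial.natDegree_map_le).trans hdeg𝒬
  · rw [Polynomial.coeff_map, Polynomial.coeff_map]
    change (rename finSumFinEquiv ((sumAlgEquiv ℤ (Fin n) (Fin r)).symm (σa (𝒬.coeff i)))).totalDegree ≤ _
    refine (totalDegree_rename_le _ _).trans ?_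
    have h := totalDegree_specA_le (r := r) a (𝒬.coeff i)
    simp only at h
    exact h.trans (hcoeff𝒬 i)
  · rw [Polynomial.coeff_map, Polynomial.coeff_map]
    change weight (rename finSumFinEquiv ((sumAlgEquiv ℤ (Fin n) (Fin r)).symm (σa (𝒬.coeff i)))) ≤ _
    rw [weight_rename_of_injective (Equiv.injective _)]
    have h := weight_specA_le (r := r) a hNa ha (𝒬.coeff i)
    simp only at h
    refine h.trans ?_
    exact Nat.mul_le_mul (hwt𝒬 i) (Nat.pow_le_pow_right hNa (hcoeff𝒬 i))

/-- **Sizes of the factor `q ∣ 𝒬_a`** (flattened coefficients in `ℤ[Fin (n + r)]`). -/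
theorem q_sizes (S : Fin t → MvPolynomial (Fin n) (MvPolynomial (Fin r) ℤ))
    {dT w₁ Na : ℕ} (hST : ∀ k β, ((S k).coeff β).totalDegree ≤ dT)
    (hSw : ∀ k, ((S k).support.sum fun β => weight ((S k).coeff β)) ≤ w₁)
    (a : Fin n × Fin t → ℕ) (hNa : 1 ≤ Na) (ha : ∀ p, a p ≤ Na) (k₀ : ℕ)
    (q : Polynomial (MvPolynomial (Fin n) (MvPolynomial (Fin r) ℤ))) :
    let ι := Fin r ⊕ (Fin n ⊕ (Fin n × Fin t))
    let F : Fin n → MvPolynomial (Fin n) (MvPolynomial ι ℤ) := fun i =>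
      ∑ k, C (X (Sum.inr (Sum.inr (i, k)))) *
        MvPolynomial.map (rename (Sum.inl : Fin r → ι) : MvPolynomial (Fin r) ℤ →ₐ[ℤ] MvPolynomial ι ℤ).toRingHom (S k)
    let uU : MvPolynomial (Fin n) (MvPolynomial ι ℤ) := ∑ j, C (X (Sum.inr (Sum.inl j))) * X j
    let 𝒬 := sLead (pertCharpoly (d + 1) F uU k₀)
    let σa : MvPolynomial ι ℤ →+* MvPolynomial (Fin n) (MvPolynomial (Fin r) ℤ) :=
      eval₂Hom (C.comp C) (Sum.elim (fun k => C (X k)) (Sum.elim (fun j => X j) (fun p => C (C ((a p : ℕ) : ℤ)))))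
    let flat₁ : MvPolynomial (Fin n) (MvPolynomial (Fin r) ℤ) →+* MvPolynomial (Fin (n + r)) ℤ :=
      (rename finSumFinEquiv : MvPolynomial (Fin n ⊕ Fin r) ℤ →ₐ[ℤ] MvPolynomial (Fin (n + r)) ℤ).toRingHom.comp
        (sumAlgEquiv ℤ (Fin n) (Fin r)).symm.toRingEquiv.toRingHom
    let N := (d + 1) ^ n
    let D := (d + 1) ^ n * (1 + k₀ * (dT + 1))
    let W := (1 + (1 + t * w₁) ^ k₀ * n) ^ ((d + 1) ^ n) * Na ^ ((d + 1) ^ n * (1 + k₀ * (dT + 1)))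
    𝒬.map σa ≠ 0 → q ∣ 𝒬.map σa →
    q.natDegree ≤ N ∧ (∀ i, (flat₁ (q.coeff i)).totalDegree ≤ D + N) ∧
      ∀ i, weight (flat₁ (q.coeff i)) ≤
        (N + 1) * W * (((D + N) + 1) * (2 * (D + N) + 1) ^ (2 * (D + N))) ^ ((n + r) + 1) := by
  intro ι F uU 𝒬 σa flat₁ N D W h0 hq
  have hflat_inj : Function.Injective flat₁ :=
    (rename_injective _ (Equiv.injective _)).comp (sumAlgEquiv ℤ (Fin n) (Fin r)).symm.injective
  have hsz := flatMap_specA_sizes (d := d) S hST hSw a hNa ha k₀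
  simp only at hsz
  obtain ⟨hN, hD, hW⟩ := hsz
  have hP0 : (𝒬.map σa).map flat₁ ≠ 0 := (Polynomial.map_ne_zero_iff hflat_inj).2 h0
  have hdvd : q.map flat₁ ∣ (𝒬.map σa).map flat₁ := Polynomial.map_dvd flat₁ hq
  obtain ⟨h1, h2, h3⟩ := factor_sizes ((𝒬.map σa).map flat₁) (q.map flat₁) hP0 hdvd hN hD hW
  refine ⟨?_, fun i => ?_, fun i => ?_⟩
  · rw [← Polynomial.natDegree_map_eq_of_injective hflat_inj q]; exact h1
  · have := h2 i; rwa [Polynomial.coeff_map] at this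
  · have := h3 i; rwa [Polynomial.coeff_map] at this

end Summit.ValiantsHypothesis.ValiantsHypothesis.Theorems.LangWeilTransfer
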